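import Mathlib
import Summits.Ventures.HodgeRepro.Tier4.Common.LocalCoordinatesConj
import Summits.Ventures.HodgeRepro.Tier4.Line4.D3CoeffConj
import Summits.Ventures.HodgeRepro.Tier4.Line4.D3CoeffDelta
import Summits.Ventures.HodgeRepro.Tier4.Line4.DefiniteCoeff
import Summits.Ventures.HodgeRepro.Tier4.Line4.DetTwist

/-!
# Tier4/Line4/D3CoeffGeneral — the `w₀`-factor of the archimedean witness for ARBITRARY displayed weights
`(eP′ w₀, eM′ w₀)` with `eP′ w₀ − eM′ w₀ = ±3`: `d3Gen m := D3coeff' · detTwist m` (weights `(m + 3, m)`) and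
`d3Gen' p := D3coeff'' · detTwist p` (weights `(p, p + 3)`)

Blind re-derivation cell `pub-hodge-repro`, Tier 4 (README §9–§10), seat t4-L1-p5 (prover, gen 5; C-L4-DEFCOEFF
S15129 / S15149, the `w₀`-half, split from `DetTwist` by the 400-line rule).  Target tree path
`lean/Summits/Ventures/HodgeRepro/Tier4/Line4/D3CoeffGeneral.lean`.  On the seat's `D3CoeffConj` (p700675: `D3coeff'`,
`cj_D3coeff'_inv_mul`, `D3coeff'_mul_of_mem_localTorusAt'_ne`), `D3CoeffDelta` (p702993: `D3coeff''`,
`cj_D3coeff''_inv_mul`), `DefiniteCoeff` (p703816: `weightAt'_ne_zero_of_mem_torusT'`) and `DetTwist`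
(`detTwist`, `cj_detTwist_inv_mul`, `norm_detTwist_le_one`, `cj_mul_inv_mul_of_laws`); no printed input.

WHY.  Display (7a) of LINE L4 (v0.34 L1145) pins the `w₀`-weights of the archimedean witness only through
`_he' : eP′ w₀ − eM′ w₀ = ±(eP w₀ − eM w₀)` with `_he : eP w₀ − eM w₀ = ±3` — i.e. `(eP′ w₀, eM′ w₀) = (m + 3, m)` or
`(p, p + 3)` for a FREE integer `m` resp. `p`; `D3coeff'` (weights `(3, 0)`) and `D3coeff''` (`(0, 3)`) are the cases
`m = 0` resp. `p = 0`.  The twist `detTwist c` (DetTwist) is a character of the local group of weight `(−c, −c)` and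
modulus `1`, so `D3coeff' · detTwist m` is a matrix coefficient of `D₃ ⊗ det^{−m}` — the discrete series of `U(1,1)`
with the same restriction to `SU(1,1)` — with the weights `(−(m + 3), −m)`.

WHAT IS PROVED (kernel, no print): `continuous_d3Gen` / `continuous_d3Gen'` (`U(1,1)` signs at `w`),
**`norm_d3Gen_le` / `norm_d3Gen'_le`** (`≤ ‖D3coeff'‖` resp. `≤ ‖D3coeff''‖`: every decay bound of the inverse-cube
coefficient — `hasDecay3_D3coeff'_of_definite` p702693, `hasDecay3_of_bump` p701824 — transfers), **`cj_d3Gen_inv_mul`**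
(`IsArchCoeff.equiv` at `w` with `(eP′ w, eM′ w) = (m + 3, m)`), **`cj_d3Gen'_inv_mul`** (`(p, p + 3)`), the `(p, m)`-forms
`cj_d3Gen_inv_mul'` (`hpm : p = m + 3`) / `cj_d3Gen'_inv_mul'` (`hpm : m = p + 3`), and
`d3Gen_mul_of_mem_localTorusAt'_ne` / `d3Gen'_mul_of_mem_localTorusAt'_ne` (the other places act trivially);
`norm_D3coeff''_eq_norm_D3coeff'` (`‖δ′‖ = ‖α′‖`: the decay of the holomorphic branch is the decay of the antiholomorphic one).

NOT here: the `arch_ne` matching for the twisted factor (the twist is a character: the `w₀`-orbital integral of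
`D3coeff' · detTwist m` is that of `D3coeff'` against the twisted characters — displayed with the rest of `arch_ne`),
`G_∞`-integrability and operator Schur (print, displayed).  Nothing here says anything about the status of the Hodge
conjecture for CM abelian varieties, which is NOT proved (HC_CM is NOT proved by anyone in this repository).
-/

set_option autoImplicit false

noncomputable section

namespace Summit.Ventures.HodgeRepro.Tier4.Line4

open Summit.Ventures.HodgeRepro.Tier4.Common Summit.Ventures.HodgeRepro.Tier4.Line1 NumberField Matrix

open scoped ComplexConjugate

section General

variable {k : Type} [Field k] [NumberField k] (q : QuadData k) (a : Fin 4 → k)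
  (g g' : Matrix (Fin 4) (Fin 4) k) (hgg' : g * g' = 1) (hg'g : g' * g = 1)
  (hgΩ : g * (PlaneData.mixedRow q (a 0) (a 2)).Ω = (PlaneData.mixedRow q (a 0) (a 2)).Ω * g)
  (lam : k) (hlam : lam ≠ 0)
  (hiso : g * (PlaneData.mixedRow q (a 1) (a 3)).B * gᵀ = lam • (PlaneData.mixedRow q (a 0) (a 2)).B)
  (w : InfinitePlace k)

/-- **the general `w₀`-factor, holomorphic branch**: `d3Gen m := D3coeff' · detTwist m`, of `T′_w`-weight
`(−(m + 3), −m)` — the `(eP′ w, eM′ w) = (m + 3, m)` coefficient (`D₃ ⊗ det^{−m}`). -/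
def d3Gen (m : ℤ) : GA ((PlaneData.mixedRow q (a 0) (a 2)).withTransportedTorus g g' hgg' hg'g hgΩ) → ℂ :=
  D3coeff' q a g g' hgg' hg'g hgΩ lam hiso w * detTwist q a g g' hgg' hg'g hgΩ lam hiso w m

/-- **the general `w₀`-factor, antiholomorphic branch**: `d3Gen' p := D3coeff'' · detTwist p`, of `T′_w`-weight
`(−p, −(p + 3))` — the `(eP′ w, eM′ w) = (p, p + 3)` coefficient. -/
def d3Gen' (p : ℤ) : GA ((PlaneData.mixedRow q (a 0) (a 2)).withTransportedTorus g g' hgg' hg'g hgΩ) → ℂ :=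
  D3coeff'' q a g g' hgg' hg'g hgΩ lam hiso w * detTwist q a g g' hgg' hg'g hgΩ lam hiso w p

/-- `d3Gen m x = D3coeff' x * detTwist m x` (`rfl`). -/
theorem d3Gen_apply (m : ℤ) (x : GA ((PlaneData.mixedRow q (a 0) (a 2)).withTransportedTorus g g' hgg' hg'g hgΩ)) :
    d3Gen q a g g' hgg' hg'g hgΩ lam hiso w m x =
      D3coeff' q a g g' hgg' hg'g hgΩ lam hiso w x * detTwist q a g g' hgg' hg'g hgΩ lam hiso w m x := rfl

/-- `d3Gen' p x = D3coeff'' x * detTwist p x` (`rfl`). -/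
theorem d3Gen'_apply (p : ℤ) (x : GA ((PlaneData.mixedRow q (a 0) (a 2)).withTransportedTorus g g' hgg' hg'g hgΩ)) :
    d3Gen' q a g g' hgg' hg'g hgΩ lam hiso w p x =
      D3coeff'' q a g g' hgg' hg'g hgΩ lam hiso w x * detTwist q a g g' hgg' hg'g hgΩ lam hiso w p x := rfl

/-- `d3Gen m` is continuous (`U(1,1)` signs at `w`). -/
theorem continuous_d3Gen (hw : w.IsReal) (hcm : IsCMAt q w)
    (ha1 : 0 < (adToC w (algebraMap k (Ad k) (a 1))).re) (ha3 : (adToC w (algebraMap k (Ad k) (-1 * a 3))).re < 0)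
    (m : ℤ) : Continuous (d3Gen q a g g' hgg' hg'g hgΩ lam hiso w m) :=
  (continuous_D3coeff' q a g g' hgg' hg'g hgΩ lam hiso w hw hcm ha1 ha3).mul
    (continuous_detTwist q a g g' hgg' hg'g hgΩ lam hiso w m)

/-- `d3Gen' p` is continuous (`U(1,1)` signs at `w`). -/
theorem continuous_d3Gen' (hw : w.IsReal) (hcm : IsCMAt q w)
    (ha1 : 0 < (adToC w (algebraMap k (Ad k) (a 1))).re) (ha3 : (adToC w (algebraMap k (Ad k) (-1 * a 3))).re < 0)
    (p : ℤ) : Continuous (d3Gen' q a g g' hgg' hg'g hgΩ lam hiso w p) :=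
  (continuous_D3coeff'' q a g g' hgg' hg'g hgΩ lam hiso w hw hcm ha1 ha3).mul
    (continuous_detTwist q a g g' hgg' hg'g hgΩ lam hiso w p)

/-- **`‖d3Gen m x‖ ≤ ‖D3coeff' x‖`** (the twist has modulus `≤ 1`): every decay bound of `D3coeff'` transfers. -/
theorem norm_d3Gen_le (hw : w.IsReal) (hcm : IsCMAt q w)
    (hA : adToC w (algebraMap k (Ad k) (a 1)) ≠ 0) (hB : adToC w (algebraMap k (Ad k) (-1 * a 3)) ≠ 0) (m : ℤ)
    (x : GA ((PlaneData.mixedRow q (a 0) (a 2)).withTransportedTorus g g' hgg' hg'g hgΩ)) :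
    ‖d3Gen q a g g' hgg' hg'g hgΩ lam hiso w m x‖ ≤ ‖D3coeff' q a g g' hgg' hg'g hgΩ lam hiso w x‖ := by
  rw [d3Gen_apply, norm_mul]
  exact mul_le_of_le_one_right (norm_nonneg _)
    (norm_detTwist_le_one q a g g' hgg' hg'g hgΩ lam hiso w hw hcm hA hB m x)

/-- **`‖d3Gen' p x‖ ≤ ‖D3coeff'' x‖`**. -/
theorem norm_d3Gen'_le (hw : w.IsReal) (hcm : IsCMAt q w)
    (hA : adToC w (algebraMap k (Ad k) (a 1)) ≠ 0) (hB : adToC w (algebraMap k (Ad k) (-1 * a 3)) ≠ 0) (p : ℤ)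
    (x : GA ((PlaneData.mixedRow q (a 0) (a 2)).withTransportedTorus g g' hgg' hg'g hgΩ)) :
    ‖d3Gen' q a g g' hgg' hg'g hgΩ lam hiso w p x‖ ≤ ‖D3coeff'' q a g g' hgg' hg'g hgΩ lam hiso w x‖ := by
  rw [d3Gen'_apply, norm_mul]
  exact mul_le_of_le_one_right (norm_nonneg _)
    (norm_detTwist_le_one q a g g' hgg' hg'g hgΩ lam hiso w hw hcm hA hB p x)

include hlam in
/-- **THE `equiv` FIELD AT `w` FOR THE WEIGHTS `(m + 3, m)`**: for `κ ∈ T′_w` and every `y`,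
`RTF.cj (d3Gen m) (κ⁻¹ y) = u₀(κ) ^ (−(m + 3)) · u₁(κ) ^ (−m) · RTF.cj (d3Gen m) y`
(`cj_D3coeff'_inv_mul` × `cj_detTwist_inv_mul` through `cj_mul_inv_mul_of_laws`). -/
theorem cj_d3Gen_inv_mul (hw : w.IsReal) (hcm : IsCMAt q w) (ha1 : a 1 ≠ 0) (ha3 : a 3 ≠ 0) (m : ℤ)
    {κ : GA ((PlaneData.mixedRow q (a 0) (a 2)).withTransportedTorus g g' hgg' hg'g hgΩ)}
    (hκ : κ ∈ localTorusAt' ((PlaneData.mixedRow q (a 0) (a 2)).withTransportedTorus g g' hgg' hg'g hgΩ) w)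
    (y : GA ((PlaneData.mixedRow q (a 0) (a 2)).withTransportedTorus g g' hgg' hg'g hgΩ)) :
    RTF.cj (d3Gen q a g g' hgg' hg'g hgΩ lam hiso w m) (κ⁻¹ * y) =
      weightAt' ((PlaneData.mixedRow q (a 0) (a 2)).withTransportedTorus g g' hgg' hg'g hgΩ) q w g g' 0 κ ^ (-(m + 3)) *
        weightAt' ((PlaneData.mixedRow q (a 0) (a 2)).withTransportedTorus g g' hgg' hg'g hgΩ) q w g g' 1 κ ^ (-m) *
        RTF.cj (d3Gen q a g g' hgg' hg'g hgΩ lam hiso w m) y := by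
  have hn0 := weightAt'_ne_zero_of_mem_torusT' q a g g' hgg' hg'g hgΩ lam hlam hiso w hw hcm ha1 ha3 0 hκ.1
  have hn1 := weightAt'_ne_zero_of_mem_torusT' q a g g' hgg' hg'g hgΩ lam hlam hiso w hw hcm ha1 ha3 1 hκ.1
  have h1 := cj_D3coeff'_inv_mul q a g g' hgg' hg'g hgΩ lam hlam hiso w hw hcm ha1 ha3 hκ y
  have h2 := cj_detTwist_inv_mul q a g g' hgg' hg'g hgΩ lam hlam hiso w hw hcm ha1 ha3 m hκ y
  have h := cj_mul_inv_mul_of_laws hn0 hn1 h1 h2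
  unfold d3Gen
  rw [h]
  congr 2
  · congr 1; ring
  · congr 1; ring

include hlam in
/-- **THE `equiv` FIELD AT `w` FOR THE WEIGHTS `(p, p + 3)`**: for `κ ∈ T′_w` and every `y`,
`RTF.cj (d3Gen' p) (κ⁻¹ y) = u₀(κ) ^ (−p) · u₁(κ) ^ (−(p + 3)) · RTF.cj (d3Gen' p) y`. -/
theorem cj_d3Gen'_inv_mul (hw : w.IsReal) (hcm : IsCMAt q w) (ha1 : a 1 ≠ 0) (ha3 : a 3 ≠ 0) (p : ℤ)
    {κ : GA ((PlaneData.mixedRow q (a 0) (a 2)).withTransportedTorus g g' hgg' hg'g hgΩ)}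
    (hκ : κ ∈ localTorusAt' ((PlaneData.mixedRow q (a 0) (a 2)).withTransportedTorus g g' hgg' hg'g hgΩ) w)
    (y : GA ((PlaneData.mixedRow q (a 0) (a 2)).withTransportedTorus g g' hgg' hg'g hgΩ)) :
    RTF.cj (d3Gen' q a g g' hgg' hg'g hgΩ lam hiso w p) (κ⁻¹ * y) =
      weightAt' ((PlaneData.mixedRow q (a 0) (a 2)).withTransportedTorus g g' hgg' hg'g hgΩ) q w g g' 0 κ ^ (-p) *
        weightAt' ((PlaneData.mixedRow q (a 0) (a 2)).withTransportedTorus g g' hgg' hg'g hgΩ) q w g g' 1 κ ^ (-(p + 3)) *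
        RTF.cj (d3Gen' q a g g' hgg' hg'g hgΩ lam hiso w p) y := by
  have hn0 := weightAt'_ne_zero_of_mem_torusT' q a g g' hgg' hg'g hgΩ lam hlam hiso w hw hcm ha1 ha3 0 hκ.1
  have hn1 := weightAt'_ne_zero_of_mem_torusT' q a g g' hgg' hg'g hgΩ lam hlam hiso w hw hcm ha1 ha3 1 hκ.1
  have h1 := cj_D3coeff''_inv_mul q a g g' hgg' hg'g hgΩ lam hlam hiso w hw hcm ha1 ha3 hκ y
  have h2 := cj_detTwist_inv_mul q a g g' hgg' hg'g hgΩ lam hlam hiso w hw hcm ha1 ha3 p hκ y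
  have h := cj_mul_inv_mul_of_laws hn0 hn1 h1 h2
  unfold d3Gen'
  rw [h]
  congr 2
  · congr 1; ring
  · congr 1; ring

include hlam in
/-- the `(p, m)`-form of `cj_d3Gen_inv_mul`: `(eP′ w, eM′ w) = (p, m)` with `p = m + 3`. -/
theorem cj_d3Gen_inv_mul' (hw : w.IsReal) (hcm : IsCMAt q w) (ha1 : a 1 ≠ 0) (ha3 : a 3 ≠ 0) {p m : ℤ}
    (hpm : p = m + 3)
    {κ : GA ((PlaneData.mixedRow q (a 0) (a 2)).withTransportedTorus g g' hgg' hg'g hgΩ)}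
    (hκ : κ ∈ localTorusAt' ((PlaneData.mixedRow q (a 0) (a 2)).withTransportedTorus g g' hgg' hg'g hgΩ) w)
    (y : GA ((PlaneData.mixedRow q (a 0) (a 2)).withTransportedTorus g g' hgg' hg'g hgΩ)) :
    RTF.cj (d3Gen q a g g' hgg' hg'g hgΩ lam hiso w m) (κ⁻¹ * y) =
      weightAt' ((PlaneData.mixedRow q (a 0) (a 2)).withTransportedTorus g g' hgg' hg'g hgΩ) q w g g' 0 κ ^ (-p) *
        weightAt' ((PlaneData.mixedRow q (a 0) (a 2)).withTransportedTorus g g' hgg' hg'g hgΩ) q w g g' 1 κ ^ (-m) *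
        RTF.cj (d3Gen q a g g' hgg' hg'g hgΩ lam hiso w m) y := by
  subst hpm
  exact cj_d3Gen_inv_mul q a g g' hgg' hg'g hgΩ lam hlam hiso w hw hcm ha1 ha3 m hκ y

include hlam in
/-- the `(p, m)`-form of `cj_d3Gen'_inv_mul`: `(eP′ w, eM′ w) = (p, m)` with `m = p + 3`. -/
theorem cj_d3Gen'_inv_mul' (hw : w.IsReal) (hcm : IsCMAt q w) (ha1 : a 1 ≠ 0) (ha3 : a 3 ≠ 0) {p m : ℤ}
    (hpm : m = p + 3)
    {κ : GA ((PlaneData.mixedRow q (a 0) (a 2)).withTransportedTorus g g' hgg' hg'g hgΩ)}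
    (hκ : κ ∈ localTorusAt' ((PlaneData.mixedRow q (a 0) (a 2)).withTransportedTorus g g' hgg' hg'g hgΩ) w)
    (y : GA ((PlaneData.mixedRow q (a 0) (a 2)).withTransportedTorus g g' hgg' hg'g hgΩ)) :
    RTF.cj (d3Gen' q a g g' hgg' hg'g hgΩ lam hiso w p) (κ⁻¹ * y) =
      weightAt' ((PlaneData.mixedRow q (a 0) (a 2)).withTransportedTorus g g' hgg' hg'g hgΩ) q w g g' 0 κ ^ (-p) *
        weightAt' ((PlaneData.mixedRow q (a 0) (a 2)).withTransportedTorus g g' hgg' hg'g hgΩ) q w g g' 1 κ ^ (-m) *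
        RTF.cj (d3Gen' q a g g' hgg' hg'g hgΩ lam hiso w p) y := by
  subst hpm
  exact cj_d3Gen'_inv_mul q a g g' hgg' hg'g hgΩ lam hlam hiso w hw hcm ha1 ha3 p hκ y

include hlam in
/-- the other places act trivially on `d3Gen m`. -/
theorem d3Gen_mul_of_mem_localTorusAt'_ne (hw : w.IsReal) (hcm : IsCMAt q w) {w' : InfinitePlace k} (hne : w' ≠ w)
    (m : ℤ) {κ : GA ((PlaneData.mixedRow q (a 0) (a 2)).withTransportedTorus g g' hgg' hg'g hgΩ)}
    (hκ : κ ∈ localTorusAt' ((PlaneData.mixedRow q (a 0) (a 2)).withTransportedTorus g g' hgg' hg'g hgΩ) w')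
    (x : GA ((PlaneData.mixedRow q (a 0) (a 2)).withTransportedTorus g g' hgg' hg'g hgΩ)) :
    d3Gen q a g g' hgg' hg'g hgΩ lam hiso w m (κ * x) = d3Gen q a g g' hgg' hg'g hgΩ lam hiso w m x := by
  rw [d3Gen_apply, d3Gen_apply, D3coeff'_mul_of_mem_localTorusAt'_ne q a g g' hgg' hg'g hgΩ lam hlam hiso w hw hcm hne hκ x,
    detTwist_mul_of_mem_localTorusAt'_ne q a g g' hgg' hg'g hgΩ lam hlam hiso w hw hcm hne m hκ x]

include hlam in
/-- the other places act trivially on `d3Gen' p`. -/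
theorem d3Gen'_mul_of_mem_localTorusAt'_ne (hw : w.IsReal) (hcm : IsCMAt q w) {w' : InfinitePlace k} (hne : w' ≠ w)
    (p : ℤ) {κ : GA ((PlaneData.mixedRow q (a 0) (a 2)).withTransportedTorus g g' hgg' hg'g hgΩ)}
    (hκ : κ ∈ localTorusAt' ((PlaneData.mixedRow q (a 0) (a 2)).withTransportedTorus g g' hgg' hg'g hgΩ) w')
    (x : GA ((PlaneData.mixedRow q (a 0) (a 2)).withTransportedTorus g g' hgg' hg'g hgΩ)) :
    d3Gen' q a g g' hgg' hg'g hgΩ lam hiso w p (κ * x) = d3Gen' q a g g' hgg' hg'g hgΩ lam hiso w p x := by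
  rw [d3Gen'_apply, d3Gen'_apply,
    D3coeff''_mul_of_mem_localTorusAt'_ne q a g g' hgg' hg'g hgΩ lam hlam hiso w hw hcm hne hκ x,
    detTwist_mul_of_mem_localTorusAt'_ne q a g g' hgg' hg'g hgΩ lam hlam hiso w hw hcm hne p hκ x]

/-- **`‖D3coeff'' x‖ = ‖D3coeff' x‖`** (`‖δ′‖ = ‖α′‖` on `U(1,1)`, `normSq_locEntry_eq`): every decay bound of `D3coeff'`
is a decay bound of `D3coeff''`. -/
theorem norm_D3coeff''_eq_norm_D3coeff' (hw : w.IsReal) (hcm : IsCMAt q w)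
    (ha1 : 0 < (adToC w (algebraMap k (Ad k) (a 1))).re) (ha3 : (adToC w (algebraMap k (Ad k) (-1 * a 3))).re < 0)
    (x : GA ((PlaneData.mixedRow q (a 0) (a 2)).withTransportedTorus g g' hgg' hg'g hgΩ)) :
    ‖D3coeff'' q a g g' hgg' hg'g hgΩ lam hiso w x‖ = ‖D3coeff' q a g g' hgg' hg'g hgΩ lam hiso w x‖ := by
  have h := (normSq_locEntry_eq q (a 1) (a 3) (-1) w hw hcm ha1 ha3 (conjTo q a g g' hgg' hg'g hgΩ lam hiso x)).2.2
  rw [Complex.normSq_eq_norm_sq, Complex.normSq_eq_norm_sq] at h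
  have h' := (pow_left_inj₀ (norm_nonneg _) (norm_nonneg _) two_ne_zero).1 h
  rw [D3coeff''_eq, D3coeff'_eq]
  unfold locEntry'
  rw [norm_pow, norm_pow, norm_inv, norm_inv, h']

end General

end Summit.Ventures.HodgeRepro.Tier4.Line4

end
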